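/-
Copyright (c) 2026 The decomp-a2c cell. All rights reserved.
Released under Apache 2.0 license as described in the file LICENSE.
-/
import Summits.AtomisticToContinuum.Crystallization.Theorems.ChartedZeroExcessLayeredLatticeLiouvilleWH

/-!
# ChartedZeroExcessLayeredLatticeLiouville — part WI «SingleGap»: single-gap equidistribution of the vertical increments of a harmonic field
  (decomp-a2c-lens-2, g58; helper of stmt-AtomisticToContinuum-26636, leaf (LD′) `ModalLipschitzZ`; brick (4a) `ModalLipschitzAt`, vertical half
  (4a⊥), step (SG) of memo NODE-g58c)

★★★ `single_gap_sq_le`.  Let `ψ` be `ϱ`-truncated-harmonic on `idxBall x₀ n`, `n ≥ 64(ϱ/c + 2)`, under coercivity `κ₀`, a tail certificate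
`ε < 2κ₀` and the Caccioppoli inequality (WA's hypothesis, discharged by VC `caccioppoli_latDiff`).  For a gap `k₀`, a centre column `γ₀` and a
half-width `R` such that the cube of half-width `R + ⌊ϱ/c⌋ + 1` about `(γ₀, k₀)` lies in `idxBall x₀ (n/8)`, the energy carried by the ONE gap `k₀` over
the `(2R+1)²` columns `γ` of the cube obeys

  `Σ_γ ‖ψ γ (k₀+1) − ψ γ k₀‖² ≤ 4·modeConst²·( 9·(196F)²/(2R+1) + 4·(2R+1)'²·(108F)²·lip/#idxBall x₀ n + (2R+1)·divConst/n² + stab²·(R+2)⁻⁴·2⌊ϱ/c⌋ )·E_n(ψ)`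

(`(2R+1)'²` = the number of columns, kept as a cardinality).  With `R ≍ n/16` every bracket term is `≍ 1/n`: the gap carries no more than its share
`E/n` of the energy of the `≍ n` gaps of the half ball — the content of step (SG).  PROOF = the square-sum over the columns of WH `increment_sq_le_master`,
its four terms bounded by (B) WG `sum_chainFlux_sq_le` + the column energies inside `E` (VC `sum_norm_latDiff_sq_le`), (C) WG `norm_colPlanar_le` with
WA `inPlane_lipschitz_core`, (A) WF `sum_colFluxDiv_sq_le_energy` on the cube, (D) the collar increments crudely inside `E`.
-/

namespace Summit.AtomisticToContinuum.Crystallization.Theorems.ChartedZeroExcessLayeredLatticeLiouville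

open Summit.AtomisticToContinuum.Crystallization.Theorems.ChartedPlanarOrderRigidityDoor (E3)
open Finset
open scoped InnerProductSpace RealInnerProductSpace BigOperators

noncomputable section SingleGap

variable {c : ℝ} {a b : E3} {w : ℤ → E3}

/-! ### WI.1  Cubes, layers and columns: counting and energy bookkeeping -/

/-- coordinates of a point of the index cube `idxBallF x₀ R`. [formal bookkeeping] -/
theorem natAbs_coord_le_of_mem_idxBallF {x₀ X : Cell 2 × ℤ} {R : ℕ} (hX : X ∈ idxBallF x₀ R) :
    (∀ j, (X.1 j - x₀.1 j).natAbs ≤ R) ∧ (X.2 - x₀.2).natAbs ≤ R := by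
  have hN : idxNorm (X - x₀) ≤ R := by exact_mod_cast mem_idxBallF_iff_idxNorm.mp hX
  exact ⟨fun j => (natAbs_fst_le_idxNorm (X - x₀) j).trans hN, (natAbs_snd_le_idxNorm (X - x₀)).trans hN⟩

/-- a point with small coordinates lies in the index cube. [formal bookkeeping] -/
theorem mk_mem_idxBallF {x₀ : Cell 2 × ℤ} {p : Cell 2} {β : ℤ} {R : ℕ} (h0 : (p 0 - x₀.1 0).natAbs ≤ R) (h1 : (p 1 - x₀.1 1).natAbs ≤ R)
    (h2 : (β - x₀.2).natAbs ≤ R) : (p, β) ∈ idxBallF x₀ R := by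
  rw [mem_idxBallF_iff_idxNorm, Nat.cast_le, show (p, β) - x₀ = (p - x₀.1, β - x₀.2) from rfl]
  exact idxNorm_mk_le h0 h1 h2

/-- re-indexing a layer × window double sum into the cube: for `L` inside one layer and `(X.1, m) ∈ Q` for `X ∈ L`, `m ∈ W`,
`Σ_{X ∈ L} Σ_{m ∈ W} g (X.1, m) ≤ Σ_{Y ∈ Q} g Y` (`g ≥ 0`). [formal bookkeeping] -/
theorem sum_layer_window_le {L Q : Finset (Cell 2 × ℤ)} {k₀ : ℤ} (hL2 : ∀ X ∈ L, X.2 = k₀) {W : Finset ℤ} (hQ : ∀ X ∈ L, ∀ m ∈ W, (X.1, m) ∈ Q)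
    (g : Cell 2 × ℤ → ℝ) (hg : ∀ Y, 0 ≤ g Y) : ∑ X ∈ L, ∑ m ∈ W, g (X.1, m) ≤ ∑ Y ∈ Q, g Y := by
  rw [← sum_product']
  refine sum_le_sum_of_injOn' (fun q : (Cell 2 × ℤ) × ℤ => (q.1.1, q.2)) (fun q hq q' hq' h => ?_)
    (fun q hq => hQ q.1 (mem_product.mp hq).1 q.2 (mem_product.mp hq).2) (fun Y _ => hg Y) fun _ _ => le_rfl
  obtain ⟨h1, h2⟩ := Prod.mk.inj h
  have e1 := hL2 q.1 (mem_product.mp (Finset.mem_coe.mp hq)).1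
  have e2 := hL2 q'.1 (mem_product.mp (Finset.mem_coe.mp hq')).1
  exact Prod.ext (Prod.ext h1 (e1.trans e2.symm)) h2

/-- the column energies of a layer of columns over a band of gaps sit inside the energy: `Σ_{X ∈ L} Σ_{k ∈ J} ‖ψ X.1 (k+1) − ψ X.1 k‖² ≤ E_n(ψ)`
whenever the columns `(X.1, k)`, `k ∈ J`, lie in `idxBall x₀ s`, `s + 1 ≤ n` (VC `sum_norm_latDiff_sq_le`). [formal bookkeeping] -/
theorem sum_layer_band_sq_le (x₀ : Cell 2 × ℤ) {n s : ℝ} (hs : s + 1 ≤ n) (ψ : Cell 2 → ℤ → E3) {L : Finset (Cell 2 × ℤ)} {k₀ : ℤ}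
    (hL2 : ∀ X ∈ L, X.2 = k₀) {J : Finset ℤ} (hLJ : ∀ X ∈ L, ∀ k ∈ J, (X.1, k) ∈ idxBall x₀ s) :
    ∑ X ∈ L, ∑ k ∈ J, ‖ψ X.1 (k + 1) - ψ X.1 k‖ ^ 2 ≤ idxEnergy ψ (idxBall x₀ n) := by
  have h1 := sum_layer_window_le hL2 (Q := idxBallF x₀ s) (W := J)
    (fun X hX k hk => by rw [← Finset.mem_coe, coe_idxBallF]; exact hLJ X hX k hk) (fun Y => ‖latDiff idxAxis₃ ψ Y.1 Y.2‖ ^ 2) fun _ => sq_nonneg _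
  have idxNorm_idxAxis₃_le : (idxNorm idxAxis₃ : ℝ) ≤ 1 := by
    have h := dist_add_idxAxis₃_le (0 : Cell 2 × ℤ)
    rwa [dist_eq_idxNorm, zero_add, sub_zero] at h
  have h2 := (sum_norm_latDiff_sq_le x₀ s ψ idxNorm_idxAxis₃_le).trans (idxEnergy_idxBall_mono ψ x₀ hs)
  simp only [latDiff_axis₃_apply] at h1 h2
  exact h1.trans h2

/-- the collar of a window has `2r` layers. [formal bookkeeping] -/
theorem card_band_sdiff_window_le (k₀ : ℤ) (R r : ℕ) : (#(Icc (k₀ - R - r) (k₀ + R + r) \ Icc (k₀ - R) (k₀ + R)) : ℝ) ≤ 2 * r := by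
  have hsub : Icc (k₀ - R - r) (k₀ + R + r) \ Icc (k₀ - R) (k₀ + R) ⊆ Icc (k₀ - R - r) (k₀ - R - 1) ∪ Icc (k₀ + R + 1) (k₀ + R + r) := by
    intro k hk
    simp only [mem_sdiff, mem_Icc, mem_union] at hk ⊢
    omega
  have h1 := (card_le_card hsub).trans (card_union_le _ _)
  rw [Int.card_Icc, Int.card_Icc] at h1
  have h2 : (k₀ - R - 1 + 1 - (k₀ - R - r)).toNat + (k₀ + R + r + 1 - (k₀ + R + 1)).toNat = 2 * r := by omega
  rw [h2] at h1
  exact_mod_cast h1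

/-- WA's Lipschitz bound as a square root: `‖latDiff E φ X‖ ≤ √(lip·E_n(φ)/#idxBall x₀ n)` on the half ball. [formal bookkeeping] -/
theorem norm_latDiff_le_sqrt (hc : 0 < c) {κ₀ ϱ : ℝ} (hκ₀ : 0 < κ₀) (hϱ : 0 ≤ ϱ)
    (hP : ∀ E₀ : Cell 2 × ℤ, E₀.2 = 0 → (idxNorm E₀ : ℝ) ≤ 1 → ∀ (y₀ : Cell 2 × ℤ) (r' n' : ℝ), r' < n' → ∀ ψ : Cell 2 → ℤ → E3,
      IsTruncHarmonicZ ϱ a b w ψ (idxBall y₀ (n' + 1)) →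
        κ₀ * idxEnergy (latDiff E₀ ψ) (idxBall y₀ r') ≤ 54 * kernelConst c * ((n' - r')⁻¹) ^ 2 * idxEnergy ψ (idxBall y₀ (n' + ϱ / c + 1)))
    {E : Cell 2 × ℤ} (hE : E.2 = 0) (hE1 : (idxNorm E : ℝ) ≤ 1) (x₀ : Cell 2 × ℤ) {n : ℝ} (hn : 16 * (ϱ / c + 2) ≤ n) {φ : Cell 2 → ℤ → E3}
    (hφ : IsTruncHarmonicZ ϱ a b w φ (idxBall x₀ n)) {X : Cell 2 × ℤ} (hX : X ∈ idxBall x₀ (n / 2)) :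
    ‖latDiff E φ X.1 X.2‖ ≤ Real.sqrt (lipConst c κ₀ * idxEnergy φ (idxBall x₀ n) / (idxBall x₀ n).ncard) := by
  have hϱc : 0 ≤ ϱ / c := div_nonneg hϱ hc.le
  have hN := ncard_idxBall_pos x₀ (show (0 : ℝ) ≤ n by linarith)
  have h := inPlane_lipschitz_core hc hκ₀ hϱ hP hE hE1 x₀ hn hφ hX
  have h2 : ‖latDiff E φ X.1 X.2‖ ^ 2 ≤ lipConst c κ₀ * idxEnergy φ (idxBall x₀ n) / (idxBall x₀ n).ncard := by
    rw [le_div_iff₀ hN]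
    linarith
  have h3 := Real.abs_le_sqrt h2
  rwa [abs_norm] at h3

/-- summing four-term bounds. [formal bookkeeping] -/
theorem sum_four_terms {ι : Type*} (L : Finset ι) (c₁ c₂ c₃ c₄ : ℝ) (f g h : ι → ℝ) :
    ∑ X ∈ L, (c₁ * f X + c₂ + c₃ * g X + c₄ * h X) = c₁ * ∑ X ∈ L, f X + #L * c₂ + c₃ * ∑ X ∈ L, g X + c₄ * ∑ X ∈ L, h X := by
  rw [sum_add_distrib, sum_add_distrib, sum_add_distrib, sum_const, nsmul_eq_mul, mul_sum, mul_sum, mul_sum]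

/-! ### WI.2  ★★★ Single-gap equidistribution -/

/-- ★★★ SINGLE-GAP EQUIDISTRIBUTION (step (SG)): for `ψ` `ϱ`-truncated-harmonic on `idxBall x₀ n`, `n ≥ 64(ϱ/c+2)`, under coercivity, the tail
certificate (`ε < 2κ₀`) and the Caccioppoli inequality, and a cube of half-width `R + ⌊ϱ/c⌋ + 1` about `(γ₀, k₀)` inside `idxBall x₀ (n/8)`:
the energy of the gap `k₀` over the columns of the cube of half-width `R` is at most
`4·modeConst²·(9·(196F)²/(2R+1) + 4·#columns·(108F)²·lip/#ball + (2R+1)·divConst/n² + stab²·(R+2)⁻⁴·2⌊ϱ/c⌋)·E_n(ψ)` — the square-sum of WH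
`increment_sq_le_master` over the columns, with (B) WG `sum_chainFlux_sq_le`, (C) WG `norm_colPlanar_le` + WA `inPlane_lipschitz_core`, (A) WF
`sum_colFluxDiv_sq_le_energy`, (D) the collar inside the energy.  The constant is `ϱ`-free except through the explicit `2⌊ϱ/c⌋` of the collar term,
which the `(R+2)⁻⁴` absorbs for `n ≥ n₁(ϱ)`. [this file, g58] -/
theorem single_gap_sq_le (hc : 0 < c) (hL : IsLayeredCrystal c a b w) {κ₀ ε ϱ : ℝ} (hκ₀ : 0 < κ₀) (hϱ : 0 ≤ ϱ) (hε : ε < 2 * κ₀)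
    (hK : CoerciveZ (layeredKernel a b w) κ₀)
    (hT : ∀ φ : Cell 2 → ℤ → E3, HasFiniteSupport φ → Summable (tailFam ϱ a b w φ) ∧ ∑' x, tailFam ϱ a b w φ x ≤ ε * nnFormZ φ)
    (hP : ∀ E₀ : Cell 2 × ℤ, E₀.2 = 0 → (idxNorm E₀ : ℝ) ≤ 1 → ∀ (y₀ : Cell 2 × ℤ) (r' n' : ℝ), r' < n' → ∀ χ : Cell 2 → ℤ → E3,
      IsTruncHarmonicZ ϱ a b w χ (idxBall y₀ (n' + 1)) →
        κ₀ * idxEnergy (latDiff E₀ χ) (idxBall y₀ r') ≤ 54 * kernelConst c * ((n' - r')⁻¹) ^ 2 * idxEnergy χ (idxBall y₀ (n' + ϱ / c + 1)))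
    (x₀ : Cell 2 × ℤ) {n : ℝ} (hn : 64 * (ϱ / c + 2) ≤ n) {ψ : Cell 2 → ℤ → E3} (hψ : IsTruncHarmonicZ ϱ a b w ψ (idxBall x₀ n))
    (γ₀ : Cell 2) (k₀ : ℤ) (R : ℕ) (hQ : ∀ X : Cell 2 × ℤ, idxNorm (X - (γ₀, k₀)) ≤ R + ⌊ϱ / c⌋₊ + 1 → X ∈ idxBall x₀ (n / 8)) :
    ∑ X ∈ idxBallF (γ₀, k₀) R with X.2 = k₀, ‖ψ X.1 (k₀ + 1) - ψ X.1 k₀‖ ^ 2 ≤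
      4 * modeConst c (κ₀ - ε / 2) ^ 2 *
        ((2 * (R : ℝ) + 1)⁻¹ * (9 * (196 * kernelConst c) ^ 2) +
          4 * #{X ∈ idxBallF (γ₀, k₀) R | X.2 = k₀} * (108 * kernelConst c) ^ 2 * lipConst c κ₀ / (idxBall x₀ n).ncard +
          (2 * (R : ℝ) + 1) * divConst c κ₀ / n ^ 2 +
          stabConst c (κ₀ - ε / 2) ^ 2 * ((((R : ℕ) : ℝ) + 2)⁻¹ ^ 2) ^ 2 * (2 * ⌊ϱ / c⌋₊)) * idxEnergy ψ (idxBall x₀ n) := by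
  have hϱc : 0 ≤ ϱ / c := div_nonneg hϱ hc.le
  have hn0 : 0 < n := by linarith
  have hn16 : 16 * (ϱ / c + 2) ≤ n := by linarith
  have hF := kernelConst_nonneg hc
  have hE0 := idxEnergy_nonneg ψ (idxBall x₀ n)
  have hN := ncard_idxBall_pos x₀ hn0.le
  have hδ : 0 < κ₀ - ε / 2 := by linarith
  have hM := modeConst_nonneg c hδ
  have hS := stabConst_nonneg hc (κ₀ - ε / 2)
  have h1C := one_le_lipConst hc hκ₀
  have hdC := divConst_nonneg hc hκ₀
  -- the cube, its layer `k₀`, the columns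
  have hL2 : ∀ X ∈ {X ∈ idxBallF (γ₀, k₀) R | X.2 = k₀}, X.2 = k₀ := fun X hX => (mem_filter.mp hX).2
  have hLc : ∀ X ∈ {X ∈ idxBallF (γ₀, k₀) R | X.2 = k₀}, ∀ j, (X.1 j - γ₀ j).natAbs ≤ R := fun X hX =>
    (natAbs_coord_le_of_mem_idxBallF (mem_filter.mp hX).1).1
  have hcube : ∀ (p : Cell 2) (β : ℤ), (p 0 - γ₀ 0).natAbs ≤ R + ⌊ϱ / c⌋₊ + 1 → (p 1 - γ₀ 1).natAbs ≤ R + ⌊ϱ / c⌋₊ + 1 →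
      (β - k₀).natAbs ≤ R + ⌊ϱ / c⌋₊ + 1 → (p, β) ∈ idxBall x₀ (n / 8) := fun p β h0 h1 h2 =>
    hQ (p, β) (by rw [show (p, β) - (γ₀, k₀) = (p - γ₀, β - k₀) from rfl]; exact idxNorm_mk_le h0 h1 h2)
  have hLW : ∀ X ∈ {X ∈ idxBallF (γ₀, k₀) R | X.2 = k₀}, ∀ m ∈ Icc (k₀ - R) (k₀ + R), (X.1, m) ∈ idxBallF (γ₀, k₀) R := fun X hX m hm => by
    have h := hLc X hX
    have hm' := mem_Icc.mp hm
    exact mk_mem_idxBallF (h 0) (h 1) (by dsimp only; omega)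
  have hLJ : ∀ X ∈ {X ∈ idxBallF (γ₀, k₀) R | X.2 = k₀}, ∀ k ∈ Icc (k₀ - R - ⌊ϱ / c⌋₊) (k₀ + R + ⌊ϱ / c⌋₊), (X.1, k) ∈ idxBall x₀ (n / 8) :=
    fun X hX k hk => by
    have h := hLc X hX
    have hk' := mem_Icc.mp hk
    exact hcube X.1 k (by have := h 0; omega) (by have := h 1; omega) (by omega)
  -- the flux index set
  have hTF : ∀ m ∈ Icc (k₀ - R) (k₀ + R), Icc (m - ⌊ϱ / c⌋₊) (m + 1 + ⌊ϱ / c⌋₊) ⊆ Icc (k₀ - R - 1 - ⌊ϱ / c⌋₊) (k₀ + R + 1 + ⌊ϱ / c⌋₊) :=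
    fun m hm => by have h := mem_Icc.mp hm; exact Icc_subset_Icc (by omega) (by omega)
  have hJW : ∀ m ∈ Icc (k₀ - R) (k₀ + R), Icc (m - ⌊ϱ / c⌋₊) (m + ⌊ϱ / c⌋₊) ⊆ Icc (k₀ - R - ⌊ϱ / c⌋₊) (k₀ + R + ⌊ϱ / c⌋₊) :=
    fun m hm => by have h := mem_Icc.mp hm; exact Icc_subset_Icc (by omega) (by omega)
  -- (C) the in-plane gradient bound `G`
  obtain ⟨G, hG0, hGsq, hGb⟩ : ∃ G : ℝ, 0 ≤ G ∧ G ^ 2 = lipConst c κ₀ * idxEnergy ψ (idxBall x₀ n) / (idxBall x₀ n).ncard ∧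
      ∀ (p : Cell 2) (β : ℤ), (p, β) ∈ idxBall x₀ (n / 2) → ‖latDiff idxAxis₁ ψ p β‖ ≤ G ∧ ‖latDiff idxAxis₂ ψ p β‖ ≤ G :=
    ⟨Real.sqrt (lipConst c κ₀ * idxEnergy ψ (idxBall x₀ n) / (idxBall x₀ n).ncard), Real.sqrt_nonneg _, Real.sq_sqrt (by positivity),
      fun p β hX => ⟨norm_latDiff_le_sqrt hc hκ₀ hϱ hP idxAxis₁_snd idxNorm_idxAxis₁_le x₀ hn16 hψ (X := (p, β)) hX,
        norm_latDiff_le_sqrt hc hκ₀ hϱ hP idxAxis₂_snd idxNorm_idxAxis₂_le x₀ hn16 hψ (X := (p, β)) hX⟩⟩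
  have hPX : ∀ X ∈ {X ∈ idxBallF (γ₀, k₀) R | X.2 = k₀}, ∀ m ∈ Icc (k₀ - R) (k₀ + R),
      ‖colPlanar ϱ a b w (Icc (k₀ - R - 1 - ⌊ϱ / c⌋₊) (k₀ + R + 1 + ⌊ϱ / c⌋₊)) ψ X.1 m‖ ≤ 108 * kernelConst c * G := by
    intro X hX m hm
    have hm' := mem_Icc.mp hm
    have hXc := hLc X hX
    refine norm_colPlanar_le hc hL ψ _ X.1 m hG0 fun p β hp hmβ hβm => hGb p β (idxBall_mono x₀ (by linarith) (hcube p β ?_ ?_ (by omega)))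
    · have h := hp 0
      have h' := hXc 0
      rw [Int.abs_eq_natAbs] at h
      omega
    · have h := hp 1
      have h' := hXc 1
      rw [Int.abs_eq_natAbs] at h
      omega
  -- the square-sum of the column master inequality
  have hcol : ∀ X ∈ {X ∈ idxBallF (γ₀, k₀) R | X.2 = k₀}, ‖ψ X.1 (k₀ + 1) - ψ X.1 k₀‖ ^ 2 ≤
      (4 * modeConst c (κ₀ - ε / 2) ^ 2 * ((#(Icc (k₀ - (R : ℤ)) (k₀ + R)) : ℝ))⁻¹) *
          (∑ m ∈ Icc (k₀ - (R : ℤ)) (k₀ + R), ‖chainFlux ϱ a b w (Icc (k₀ - R - 1 - ⌊ϱ / c⌋₊) (k₀ + R + 1 + ⌊ϱ / c⌋₊)) (ψ X.1) m‖ ^ 2) +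
        16 * modeConst c (κ₀ - ε / 2) ^ 2 * (108 * kernelConst c * G) ^ 2 +
        (4 * modeConst c (κ₀ - ε / 2) ^ 2 * #(Icc (k₀ - (R : ℤ)) (k₀ + R))) *
          (∑ m ∈ Icc (k₀ - (R : ℤ)) (k₀ + R), ‖colFlux ϱ a b w (Icc (k₀ - R - 1 - ⌊ϱ / c⌋₊) (k₀ + R + 1 + ⌊ϱ / c⌋₊)) ψ X.1 m -
            colFlux ϱ a b w (Icc (k₀ - R - 1 - ⌊ϱ / c⌋₊) (k₀ + R + 1 + ⌊ϱ / c⌋₊)) ψ X.1 (m - 1)‖ ^ 2) +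
        (4 * modeConst c (κ₀ - ε / 2) ^ 2 * (stabConst c (κ₀ - ε / 2) ^ 2 * ((((((R : ℕ) : ℝ)) + 2)⁻¹) ^ 2) ^ 2)) *
          (∑ k ∈ Icc (k₀ - R - ⌊ϱ / c⌋₊) (k₀ + R + ⌊ϱ / c⌋₊) \ Icc (k₀ - R) (k₀ + R), ‖ψ X.1 (k + 1) - ψ X.1 k‖) ^ 2 := by
    intro X hX
    have h := increment_sq_le_master hc hL hϱ hε hK hT ψ X.1 hTF (P := 108 * kernelConst c * G)
      (D := ∑ k ∈ Icc (k₀ - R - ⌊ϱ / c⌋₊) (k₀ + R + ⌊ϱ / c⌋₊) \ Icc (k₀ - R) (k₀ + R), ‖ψ X.1 (k + 1) - ψ X.1 k‖) (by positivity)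
      (sum_nonneg fun _ _ => norm_nonneg _) (hPX X hX)
      fun k hk => single_le_sum (f := fun k => ‖ψ X.1 (k + 1) - ψ X.1 k‖) (fun _ _ => norm_nonneg _) hk
    exact h.trans (le_of_eq (by ring))
  have hsum := (sum_le_sum hcol).trans (le_of_eq (sum_four_terms _ _ _ _ _ _ _ _))
  -- (B) the chain flux in mean square, then the column energies inside `E`
  have hEJ := sum_layer_band_sq_le x₀ (n := n) (s := n / 8) (by linarith) ψ hL2 hLJ
  have hB : ∑ X ∈ idxBallF (γ₀, k₀) R with X.2 = k₀,
      ∑ m ∈ Icc (k₀ - (R : ℤ)) (k₀ + R), ‖chainFlux ϱ a b w (Icc (k₀ - R - 1 - ⌊ϱ / c⌋₊) (k₀ + R + 1 + ⌊ϱ / c⌋₊)) (ψ X.1) m‖ ^ 2 ≤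
      9 * (196 * kernelConst c) ^ 2 * idxEnergy ψ (idxBall x₀ n) := by
    refine (sum_le_sum fun X _ => sum_chainFlux_sq_le hc hL (ψ X.1) hTF hJW).trans ?_
    rw [← mul_sum]
    exact mul_le_mul_of_nonneg_left hEJ (by positivity)
  -- (A) the divergence in mean square on the cube
  have hA : ∑ X ∈ idxBallF (γ₀, k₀) R with X.2 = k₀, ∑ m ∈ Icc (k₀ - (R : ℤ)) (k₀ + R),
      ‖colFlux ϱ a b w (Icc (k₀ - R - 1 - ⌊ϱ / c⌋₊) (k₀ + R + 1 + ⌊ϱ / c⌋₊)) ψ X.1 m -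
        colFlux ϱ a b w (Icc (k₀ - R - 1 - ⌊ϱ / c⌋₊) (k₀ + R + 1 + ⌊ϱ / c⌋₊)) ψ X.1 (m - 1)‖ ^ 2 ≤
      divConst c κ₀ * idxEnergy ψ (idxBall x₀ n) / n ^ 2 := by
    have hXs : ∀ Y ∈ idxBallF (γ₀, k₀) R, Y ∈ idxBall x₀ (n / 8) := fun Y hY => by
      have h := natAbs_coord_le_of_mem_idxBallF hY
      have e : Y = (Y.1, Y.2) := rfl
      rw [e]
      exact hcube Y.1 Y.2 (by have := h.1 0; dsimp only at this; omega) (by have := h.1 1; dsimp only at this; omega)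
        (by have := h.2; dsimp only at this; omega)
    have hSQ : ∀ Y ∈ idxBallF (γ₀, k₀) R, ∀ Z : Cell 2 × ℤ, ‖lsite a b w Z.1 Z.2 - lsite a b w Y.1 Y.2‖ ≤ ϱ →
        Z.2 ∈ Icc (k₀ - R - 1 - ⌊ϱ / c⌋₊) (k₀ + R + 1 + ⌊ϱ / c⌋₊) := fun Y hY Z hZ => by
      have h1 : (Z.2 - Y.2).natAbs ≤ ⌊ϱ / c⌋₊ := (natAbs_snd_le_idxNorm (Z - Y)).trans (idxNorm_le_of_near hc hL hZ)
      have h2 := (natAbs_coord_le_of_mem_idxBallF hY).2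
      dsimp only at h2
      rw [mem_Icc]
      omega
    have h := sum_colFluxDiv_sq_le_energy hc hL hκ₀ hϱ hP x₀ hn hψ hXs hSQ
    have h' := sum_layer_window_le hL2 hLW (fun Y => ‖colFlux ϱ a b w (Icc (k₀ - R - 1 - ⌊ϱ / c⌋₊) (k₀ + R + 1 + ⌊ϱ / c⌋₊)) ψ Y.1 Y.2 -
      colFlux ϱ a b w (Icc (k₀ - R - 1 - ⌊ϱ / c⌋₊) (k₀ + R + 1 + ⌊ϱ / c⌋₊)) ψ Y.1 (Y.2 - 1)‖ ^ 2) fun _ => sq_nonneg _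
    have h'' := mul_le_mul_of_nonneg_right h' (sq_nonneg n)
    rw [le_div_iff₀ (by positivity)]
    linarith
  -- (D) the collar increments inside `E`
  have hD : ∑ X ∈ idxBallF (γ₀, k₀) R with X.2 = k₀,
      (∑ k ∈ Icc (k₀ - R - ⌊ϱ / c⌋₊) (k₀ + R + ⌊ϱ / c⌋₊) \ Icc (k₀ - R) (k₀ + R), ‖ψ X.1 (k + 1) - ψ X.1 k‖) ^ 2 ≤
      2 * ⌊ϱ / c⌋₊ * idxEnergy ψ (idxBall x₀ n) := by
    have hcoll := card_band_sdiff_window_le k₀ R ⌊ϱ / c⌋₊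
    refine (sum_le_sum fun X _ => sq_sum_le_card_mul_sum_sq.trans (mul_le_mul hcoll
      (sum_le_sum_of_subset_of_nonneg sdiff_subset fun k _ _ => sq_nonneg ‖ψ X.1 (k + 1) - ψ X.1 k‖)
      (sum_nonneg fun _ _ => sq_nonneg _) (by positivity))).trans ?_
    rw [← mul_sum]
    exact mul_le_mul_of_nonneg_left hEJ (by positivity)
  -- the window has `2R + 1` layers
  have hWn : #(Icc (k₀ - (R : ℤ)) (k₀ + R)) = 2 * R + 1 := by
    rw [Int.card_Icc]
    omega
  have hWc : (#(Icc (k₀ - (R : ℤ)) (k₀ + R)) : ℝ) = 2 * R + 1 := by exact_mod_cast hWn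
  -- assembling
  refine hsum.trans ?_
  rw [hWc]
  have e1 := mul_le_mul_of_nonneg_left hB (show 0 ≤ 4 * modeConst c (κ₀ - ε / 2) ^ 2 * (2 * (R : ℝ) + 1)⁻¹ by positivity)
  have e3 := mul_le_mul_of_nonneg_left hA (show 0 ≤ 4 * modeConst c (κ₀ - ε / 2) ^ 2 * (2 * (R : ℝ) + 1) by positivity)
  have e4 := mul_le_mul_of_nonneg_left hD
    (show 0 ≤ 4 * modeConst c (κ₀ - ε / 2) ^ 2 * (stabConst c (κ₀ - ε / 2) ^ 2 * ((((((R : ℕ) : ℝ)) + 2)⁻¹) ^ 2) ^ 2) by positivity)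
  have hLn : (0 : ℝ) ≤ #{X ∈ idxBallF (γ₀, k₀) R | X.2 = k₀} := Nat.cast_nonneg _
  have e2 : (#{X ∈ idxBallF (γ₀, k₀) R | X.2 = k₀} : ℝ) *
      (16 * modeConst c (κ₀ - ε / 2) ^ 2 * (108 * kernelConst c * G) ^ 2) =
      #{X ∈ idxBallF (γ₀, k₀) R | X.2 = k₀} * (16 * modeConst c (κ₀ - ε / 2) ^ 2 * ((108 * kernelConst c) ^ 2 *
        (lipConst c κ₀ * idxEnergy ψ (idxBall x₀ n) / (idxBall x₀ n).ncard))) := by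
    rw [mul_pow, hGsq]
  rw [e2]
  refine (add_le_add (add_le_add (add_le_add e1 le_rfl) e3) e4).trans (le_of_eq ?_)
  ring

/-! ### WI.3  The closed statement of this part -/

/-- The content of part WI as one closed proposition: single-gap equidistribution. -/
def SingleGapShape : Prop :=
  ∀ c : ℝ, 0 < c → ∀ (a b : E3) (w : ℤ → E3), IsLayeredCrystal c a b w → ∀ κ₀ ε ϱ : ℝ, 0 < κ₀ → 0 ≤ ϱ → ε < 2 * κ₀ →
    CoerciveZ (layeredKernel a b w) κ₀ →
    (∀ φ : Cell 2 → ℤ → E3, HasFiniteSupport φ → Summable (tailFam ϱ a b w φ) ∧ ∑' x, tailFam ϱ a b w φ x ≤ ε * nnFormZ φ) →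
    (∀ E₀ : Cell 2 × ℤ, E₀.2 = 0 → (idxNorm E₀ : ℝ) ≤ 1 → ∀ (y₀ : Cell 2 × ℤ) (r' n' : ℝ), r' < n' → ∀ χ : Cell 2 → ℤ → E3,
      IsTruncHarmonicZ ϱ a b w χ (idxBall y₀ (n' + 1)) →
        κ₀ * idxEnergy (latDiff E₀ χ) (idxBall y₀ r') ≤ 54 * kernelConst c * ((n' - r')⁻¹) ^ 2 * idxEnergy χ (idxBall y₀ (n' + ϱ / c + 1))) →
    ∀ (x₀ : Cell 2 × ℤ) (n : ℝ), 64 * (ϱ / c + 2) ≤ n → ∀ ψ : Cell 2 → ℤ → E3, IsTruncHarmonicZ ϱ a b w ψ (idxBall x₀ n) →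
    ∀ (γ₀ : Cell 2) (k₀ : ℤ) (R : ℕ), (∀ X : Cell 2 × ℤ, idxNorm (X - (γ₀, k₀)) ≤ R + ⌊ϱ / c⌋₊ + 1 → X ∈ idxBall x₀ (n / 8)) →
    ∑ X ∈ idxBallF (γ₀, k₀) R with X.2 = k₀, ‖ψ X.1 (k₀ + 1) - ψ X.1 k₀‖ ^ 2 ≤
      4 * modeConst c (κ₀ - ε / 2) ^ 2 *
        ((2 * (R : ℝ) + 1)⁻¹ * (9 * (196 * kernelConst c) ^ 2) +
          4 * #{X ∈ idxBallF (γ₀, k₀) R | X.2 = k₀} * (108 * kernelConst c) ^ 2 * lipConst c κ₀ / (idxBall x₀ n).ncard +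
          (2 * (R : ℝ) + 1) * divConst c κ₀ / n ^ 2 +
          stabConst c (κ₀ - ε / 2) ^ 2 * ((((R : ℕ) : ℝ) + 2)⁻¹ ^ 2) ^ 2 * (2 * ⌊ϱ / c⌋₊)) * idxEnergy ψ (idxBall x₀ n)

/-- WI holds. [this file, g58] -/
theorem singleGapShape_holds : SingleGapShape :=
  fun _c hc _a _b _w hL _κ₀ _ε _ϱ hκ₀ hϱ hε hK hT hP x₀ _n hn _ψ hψ γ₀ k₀ R hQ => single_gap_sq_le hc hL hκ₀ hϱ hε hK hT hP x₀ hn hψ γ₀ k₀ R hQ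

end SingleGap

end Summit.AtomisticToContinuum.Crystallization.Theorems.ChartedZeroExcessLayeredLatticeLiouville
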